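import Mathlib

/-!
# `DivisionGap.PerMultiplesHard` (stmt-ValiantsHypothesis-5068), line `uncharged-face-walk`:
type rigidity of spread probes (stub `stub_spreadRigidity`)

Pure finite combinatorics on permutations of `Fin n`.  Fix a permutation `ζ` of `Fin n` (the
stub takes `ζ := finRotate n`, `i ↦ i + 1`).  For `S, T ⊆ Fin n` with `#S = k` in the window
`n < 5k ≤ 2n`, call a permutation `π` COMPATIBLE with `(S, T)` when
(a) every `i ∈ S` has `π⁻¹ i ∈ T` or `π⁻¹ (ζ i) ∈ T`, and (b) every `j ∈ T` has `π j ∈ S` or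
`π j ∈ ζ(S)`.  Then `#compatible · 5^{⌊n/10⌋} ≤ 4^{⌊n/10⌋} · n!` (`spreadRigidity_gen`; the
registered stub `stub_spreadRigidity` is the case `ζ := finRotate n`).

Proof.  Compatibility depends on `π` only through `U := π(T)`: (b) says `U ⊆ W := S ∪ ζ(S)`
(`#W ≤ 2k`) and (a) says every `i ∈ S` has `i ∈ U` or `ζ i ∈ U`.  So the compatible set is
covered by the fibres `{π | π(T) = U}` over the valid `U` (all of size `u := #T`); each fibre has
at most `u! (n-u)!` elements (restrict `π` to injections `T ↪ U` and `Tᶜ ↪ Uᶜ`); there are at most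
`C(2k, u)` valid `U`; and a valid `U` covers `S ⊆ U ∪ ζ⁻¹(U)`, so `k ≤ 2u`, whence
`⌊n/10⌋ ≤ u`.  Finally `C(2k,u) u! (n-u)! 5^f ≤ 4^f n!` for `f ≤ u` because
`(2k)(2k-1)⋯(2k-u+1) · 5^f ≤ 4^f · n(n-1)⋯(n-u+1)` termwise (`5(2k-l) ≤ 4(n-l)` as `10k ≤ 4n`
for the first `f` factors, `2k - l ≤ n - l` for the rest).
-/

set_option linter.dupNamespace false

namespace Summit.ValiantsHypothesis.ValiantsHypothesis.Theorems.DivisionGap.PerMultiplesHard.SpreadRigidity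

open scoped NNReal BigOperators

/-- Descending-factorial ratio bound: if `5a ≤ 4b` then
`a(a-1)⋯(a-u+1) · 5^f ≤ 4^f · b(b-1)⋯(b-u+1)` for every `f ≤ u`. [folklore] -/
theorem descFactorial_mul_five_pow_le (a b : ℕ) (hab : 5 * a ≤ 4 * b) :
    ∀ u f : ℕ, f ≤ u → a.descFactorial u * 5 ^ f ≤ 4 ^ f * b.descFactorial u := by
  intro u
  induction u with
  | zero =>
    intro f hf
    obtain rfl : f = 0 := Nat.le_zero.mp hf
    simp
  | succ u ih =>
    intro f hf
    rcases Nat.lt_or_ge u f with h | h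
    · obtain rfl : f = u + 1 := le_antisymm hf h
      have key := ih u le_rfl
      have h2 : (a - u) * 5 ≤ 4 * (b - u) := by omega
      rw [Nat.descFactorial_succ, Nat.descFactorial_succ, pow_succ, pow_succ]
      calc (a - u) * a.descFactorial u * (5 ^ u * 5)
          = ((a - u) * 5) * (a.descFactorial u * 5 ^ u) := by ring
        _ ≤ (4 * (b - u)) * (4 ^ u * b.descFactorial u) := Nat.mul_le_mul h2 key
        _ = 4 ^ u * 4 * ((b - u) * b.descFactorial u) := by ring
    · have key := ih f h
      have h2 : a - u ≤ b - u := by omega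
      rw [Nat.descFactorial_succ, Nat.descFactorial_succ]
      calc (a - u) * a.descFactorial u * 5 ^ f
          = (a - u) * (a.descFactorial u * 5 ^ f) := by ring
        _ ≤ (b - u) * (4 ^ f * b.descFactorial u) := Nat.mul_le_mul h2 key
        _ = 4 ^ f * ((b - u) * b.descFactorial u) := by ring

/-- Fibre bound: the permutations of `Fin n` mapping `T` onto a set `U` of the same size number at
most `#T ! · (n - #T)!` (restriction gives an injection into `(T ↪ U) × (Tᶜ ↪ Uᶜ)`). [folklore] -/
theorem card_filter_image_eq_le {n : ℕ} (T U : Finset (Fin n)) (hU : U.card = T.card) :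
    ((Finset.univ : Finset (Equiv.Perm (Fin n))).filter
        fun π : Equiv.Perm (Fin n) => T.image ⇑π = U).card ≤
      T.card.factorial * (n - T.card).factorial := by
  classical
  set F := (Finset.univ : Finset (Equiv.Perm (Fin n))).filter
    fun π : Equiv.Perm (Fin n) => T.image ⇑π = U with hF
  have key : ∀ π : Equiv.Perm (Fin n), π ∈ F → ∀ x, x ∈ T ↔ π x ∈ U := by
    intro π hπ x
    rw [hF, Finset.mem_filter] at hπ
    rw [← hπ.2, Finset.mem_image]
    constructor
    · intro hx
      exact ⟨x, hx, rfl⟩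
    · rintro ⟨y, hy, hxy⟩
      rw [← π.injective hxy]
      exact hy
  have keyc : ∀ π : Equiv.Perm (Fin n), π ∈ F → ∀ x, x ∈ Tᶜ → π x ∈ Uᶜ := by
    intro π hπ x hx
    rw [Finset.mem_compl] at hx ⊢
    exact fun h => hx ((key π hπ x).mpr h)
  let φ : F → (T ↪ U) × ((Tᶜ : Finset (Fin n)) ↪ (Uᶜ : Finset (Fin n))) := fun π =>
    (⟨fun x => ⟨π.1 x, (key π.1 π.2 x).mp x.2⟩, fun x y h =>
        Subtype.ext (π.1.injective (congrArg Subtype.val h))⟩,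
     ⟨fun x => ⟨π.1 x, keyc π.1 π.2 x x.2⟩, fun x y h =>
        Subtype.ext (π.1.injective (congrArg Subtype.val h))⟩)
  have hφ : Function.Injective φ := by
    rintro ⟨π₁, h₁⟩ ⟨π₂, h₂⟩ h
    have h1 : ∀ x : T, π₁ x = π₂ x := fun x => by
      have := congrArg (fun p => (p.1 x : U).1) h
      simpa [φ] using this
    have h2 : ∀ x : (Tᶜ : Finset (Fin n)), π₁ x = π₂ x := fun x => by
      have := congrArg (fun p => (p.2 x : (Uᶜ : Finset (Fin n))).1) h
      simpa [φ] using this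
    refine Subtype.ext (Equiv.ext fun x => ?_)
    by_cases hx : x ∈ T
    · exact h1 ⟨x, hx⟩
    · exact h2 ⟨x, Finset.mem_compl.mpr hx⟩
  have hcard := Fintype.card_le_of_injective φ hφ
  rw [Fintype.card_coe, Fintype.card_prod, Fintype.card_embedding_eq,
    Fintype.card_embedding_eq, Fintype.card_coe, Fintype.card_coe, Fintype.card_coe,
    Fintype.card_coe, Finset.card_compl, Finset.card_compl, Fintype.card_fin, hU,
    Nat.descFactorial_self, Nat.descFactorial_self] at hcard
  exact hcard

/-- **Type rigidity of spread probes, general shift.**  Fix a permutation `ζ` of `Fin n`.  For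
`S, T ⊆ Fin n` with `#S = k` in the window `n < 5k ≤ 2n`, at most `(4/5)^{⌊n/10⌋} · n!`
permutations `π` are compatible with `(S, T)` (every `i ∈ S` sees `T` through one of its two
probe columns `π⁻¹ i`, `π⁻¹ (ζ i)`, and every `j ∈ T` is a probe column of a row of `S`):
`#compatible · 5^{⌊n/10⌋} ≤ 4^{⌊n/10⌋} · n!`. [folklore] -/
theorem spreadRigidity_gen (n k : ℕ) (ζ : Equiv.Perm (Fin n)) (S T : Finset (Fin n))
    (hS : S.card = k) (hlo : n < 5 * k) (hhi : 5 * k ≤ 2 * n) :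
    ((Finset.univ : Finset (Equiv.Perm (Fin n))).filter fun π =>
        (∀ i ∈ S, π.symm i ∈ T ∨ π.symm (ζ i) ∈ T) ∧
        (∀ j ∈ T, π j ∈ S ∨ ∃ i ∈ S, ζ i = π j)).card * 5 ^ (n / 10) ≤
      4 ^ (n / 10) * n.factorial := by
  classical
  -- the pieces of the count
  set u : ℕ := T.card with hu
  set W : Finset (Fin n) := S ∪ S.image ⇑ζ with hW
  set V : Finset (Finset (Fin n)) :=
    (W.powersetCard u).filter fun U => ∀ i ∈ S, i ∈ U ∨ ζ i ∈ U with hV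
  set Fib : Finset (Fin n) → Finset (Equiv.Perm (Fin n)) := fun U =>
    (Finset.univ : Finset (Equiv.Perm (Fin n))).filter
      fun π : Equiv.Perm (Fin n) => T.image ⇑π = U with hFib
  set C : Finset (Equiv.Perm (Fin n)) :=
    (Finset.univ : Finset (Equiv.Perm (Fin n))).filter fun π =>
      (∀ i ∈ S, π.symm i ∈ T ∨ π.symm (ζ i) ∈ T) ∧
      (∀ j ∈ T, π j ∈ S ∨ ∃ i ∈ S, ζ i = π j) with hC
  -- (1) compatibility depends only on the image `π(T)`, which must be valid
  have hsub : C ⊆ V.biUnion Fib := by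
    intro π hπ
    rw [hC, Finset.mem_filter] at hπ
    obtain ⟨-, ha, hb⟩ := hπ
    rw [Finset.mem_biUnion]
    refine ⟨T.image ⇑π, ?_, ?_⟩
    · rw [hV, Finset.mem_filter, Finset.mem_powersetCard]
      refine ⟨⟨?_, Finset.card_image_of_injective _ π.injective⟩, ?_⟩
      · intro x hx
        rw [Finset.mem_image] at hx
        obtain ⟨j, hj, rfl⟩ := hx
        rcases hb j hj with h | ⟨i, hi, h⟩
        · exact Finset.mem_union_left _ h
        · exact Finset.mem_union_right _ (Finset.mem_image.mpr ⟨i, hi, h⟩)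
      · intro i hi
        rcases ha i hi with h | h
        · exact Or.inl (Finset.mem_image.mpr ⟨π.symm i, h, π.apply_symm_apply i⟩)
        · exact Or.inr (Finset.mem_image.mpr ⟨_, h, π.apply_symm_apply _⟩)
    · rw [hFib, Finset.mem_filter]
      exact ⟨Finset.mem_univ _, rfl⟩
  -- (2) there are at most `C(2k, u)` valid images
  have hWcard : W.card ≤ 2 * k := by
    calc W.card ≤ S.card + (S.image ⇑ζ).card := Finset.card_union_le _ _
      _ ≤ S.card + S.card := Nat.add_le_add_left Finset.card_image_le _
      _ = 2 * k := by omega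
  have hVcard : V.card ≤ (2 * k).choose u := by
    calc V.card ≤ (W.powersetCard u).card := Finset.card_filter_le _ _
      _ = W.card.choose u := Finset.card_powersetCard _ _
      _ ≤ (2 * k).choose u := Nat.choose_le_choose u hWcard
  -- (3) each fibre has at most `u! (n-u)!` elements, so `#C ≤ C(2k,u) u! (n-u)!`
  have hCcard : C.card ≤ (2 * k).choose u * (u.factorial * (n - u).factorial) := by
    calc C.card ≤ (V.biUnion Fib).card := Finset.card_le_card hsub
      _ ≤ ∑ U ∈ V, (Fib U).card := Finset.card_biUnion_le
      _ ≤ ∑ _U ∈ V, u.factorial * (n - u).factorial := by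
          refine Finset.sum_le_sum fun U hU => ?_
          rw [hV, Finset.mem_filter, Finset.mem_powersetCard] at hU
          exact card_filter_image_eq_le T U hU.1.2
      _ = V.card * (u.factorial * (n - u).factorial) := by rw [Finset.sum_const, smul_eq_mul]
      _ ≤ (2 * k).choose u * (u.factorial * (n - u).factorial) := Nat.mul_le_mul_right _ hVcard
  -- (4) if `C` is nonempty then some valid `U` exists, forcing `k ≤ 2u` and `⌊n/10⌋ ≤ u`
  rcases C.eq_empty_or_nonempty with hCe | hCne
  · rw [hCe]
    simp
  have hfu : n / 10 ≤ u := by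
    obtain ⟨π, hπ⟩ := hCne
    have hπ' := hsub hπ
    rw [Finset.mem_biUnion] at hπ'
    obtain ⟨U, hUV, -⟩ := hπ'
    rw [hV, Finset.mem_filter, Finset.mem_powersetCard] at hUV
    obtain ⟨⟨-, hUcard⟩, hcov⟩ := hUV
    have hSsub : S ⊆ U ∪ U.image ⇑ζ.symm := by
      intro i hi
      rcases hcov i hi with h | h
      · exact Finset.mem_union_left _ h
      · exact Finset.mem_union_right _
          (Finset.mem_image.mpr ⟨ζ i, h, ζ.symm_apply_apply i⟩)
    have hk2 : S.card ≤ U.card + U.card := by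
      calc S.card ≤ (U ∪ U.image ⇑ζ.symm).card := Finset.card_le_card hSsub
        _ ≤ U.card + (U.image ⇑ζ.symm).card := Finset.card_union_le _ _
        _ ≤ U.card + U.card := Nat.add_le_add_left Finset.card_image_le _
    omega
  -- (5) the numerical inequality
  have hun : u ≤ n := by
    have := Finset.card_le_univ T
    rwa [Fintype.card_fin] at this
  have hab : 5 * (2 * k) ≤ 4 * n := by omega
  have hnum := descFactorial_mul_five_pow_le (2 * k) n hab u (n / 10) hfu
  calc C.card * 5 ^ (n / 10)
      ≤ (2 * k).choose u * (u.factorial * (n - u).factorial) * 5 ^ (n / 10) :=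
        Nat.mul_le_mul_right _ hCcard
    _ = (2 * k).descFactorial u * 5 ^ (n / 10) * (n - u).factorial := by
        rw [Nat.descFactorial_eq_factorial_mul_choose]; ring
    _ ≤ 4 ^ (n / 10) * n.descFactorial u * (n - u).factorial :=
        Nat.mul_le_mul_right _ hnum
    _ = 4 ^ (n / 10) * n.factorial := by
        rw [← Nat.factorial_mul_descFactorial hun]; ring

/-- **Type rigidity of spread probes** (registered stub; `spreadRigidity_gen` with the shift
`ζ := finRotate n`, `i ↦ i + 1`).  For `S, T ⊆ Fin n` with `#S = k` in the window
`n < 5k ≤ 2n`, at most `(4/5)^{⌊n/10⌋} · n!` permutations `π` are compatible with `(S, T)`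
(every `i ∈ S` sees `T` through one of its two probe columns `π⁻¹ i`, `π⁻¹ (i+1)`, and every
`j ∈ T` is a probe column of a row of `S`): `#compatible · 5^{⌊n/10⌋} ≤ 4^{⌊n/10⌋} · n!`.
[folklore] -/
theorem stub_spreadRigidity :
    ∀ (n k : ℕ) (S T : Finset (Fin n)), S.card = k → n < 5 * k → 5 * k ≤ 2 * n →
      ((Finset.univ : Finset (Equiv.Perm (Fin n))).filter fun π =>
          (∀ i ∈ S, π.symm i ∈ T ∨ π.symm (finRotate n i) ∈ T) ∧
          (∀ j ∈ T, π j ∈ S ∨ ∃ i ∈ S, finRotate n i = π j)).card * 5 ^ (n / 10) ≤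
        4 ^ (n / 10) * n.factorial :=
  fun n k S T hS hlo hhi => spreadRigidity_gen n k (finRotate n) S T hS hlo hhi

end Summit.ValiantsHypothesis.ValiantsHypothesis.Theorems.DivisionGap.PerMultiplesHard.SpreadRigidity
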